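import Mathlib
import Summits.ResolutionOfSingularities.ResolutionOfSingularities.Theorems.HomologicalConductorPersistenceSurfaceSaturationResidualFour
import Summits.ResolutionOfSingularities.ResolutionOfSingularities.Theorems.HomologicalConductorPersistenceRecurrenceExclusion
import Summits.ResolutionOfSingularities.ResolutionOfSingularities.Theorems.HomologicalConductorNoZenoDim2RegularCentre
import Summits.ResolutionOfSingularities.ResolutionOfSingularities.Theorems.HomologicalConductorNoZenoTowerNoetherian
import HarnessLib

/-!
# Rung S-2 `PersistenceSurface` (stmt-ResolutionOfSingularities-19970) — the Sat₄ residual `SaturationFourSurfaceResidual₄`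
# READ IN SYZYGY CURRENCY AT ONE LEVEL, and SPLIT «stage 0 / normal stages»

Route `ResolutionOfSingularities/HomologicalConductor`, chain W4.4b, rung S-2 `PersistenceSurface`
(stmt-ResolutionOfSingularities-19970), registered skeleton 1a77c002 (stub `stub_saturationFourSurfaceResidualFour :
SaturationFourSurfaceResidual₄`).  [OURS · AI-written bookkeeping over LANDED tree lemmas, weaker than expert review;
NOT a statement of the manuscript under study (Hironaka 2017) and no statement of that manuscript is used.]
DEF-FREE helper: no new `def`, no new conjecture; every hypothesis is spelled inline.

The fourth residual (`…PersistenceSurfaceSaturationResidualFour`, p-lineage o12‴) asks for the saturation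
`ca(T_m) ⊆ ca⁴(T_m)` at the stages `T_m` of a surface tower that are not regular, not monic-hypersurface
localisations, not edim-candidates, of Krull dimension `2`, with a singular successor.  This file records the two
reductions the tree already affords, so that the residual's CONTENT is named exactly:

* `ca_subset_caAt_of_forall_isSyzygy_retract_at` — STAGE LEVEL, route vocabulary: if over the (noetherian) stage
  `↥T` every `d`-th syzygy module of a finitely generated module is a retract of a `(d+1)`-th syzygy module of a
  finitely generated module (the retract property `(SC_d)` at the SINGLE level `d`,
  `RecurrenceExclusion.cohomologyAnnihilator_eq_of_forall_isSyzygy_retract_at`), then `ca T ⊆ caAt n T` for every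
  `n ≥ d + 1` (adapter `PeriodicSaturationStage.ca_subset_caAt_of_le`).
* `saturationFourSurfaceResidual₄_of_forall_isSyzygy_three_retract` — `(SC₃)` at every residual stage
  (every THIRD syzygy module over `↥(tower O A m)` a retract of a FOURTH syzygy module) ⇒
  `SaturationFourSurfaceResidual₄`.  So the stub is a statement about third syzygy modules over two-dimensional
  local domains essentially of finite type over `k`, nothing else.
* `saturationFourSurfaceResidual₄_of_stageZero_of_isIntegrallyClosed` — every stage `T_(m+1)` is integrally
  closed (`NoZeno.Birth.d2rc_isIntegrallyClosed_tower_succ`), so the residual splits into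
  (0) `Sat₄` at the (possibly non-normal) stage `T_0 = loc A` under the residual clauses, and
  (N) `Sat₄` at the INTEGRALLY CLOSED residual stages (two-dimensional normal local domains, hence Cohen–Macaulay
  on paper — Serre; not used here);
* `saturationFourSurfaceResidual₄_of_stageZero_of_forall_isSyzygy_three_retract_of_isIntegrallyClosed` — the two
  combined: (0) as above and `(SC₃)` at the integrally closed residual stages ⇒ `SaturationFourSurfaceResidual₄`.

READING.  On paper `(SC₃)` holds at every Gorenstein normal surface stage (maximal Cohen–Macaulay modules are
cosyzygies, second syzygies are MCM), so after this file the fourth residual's content is: `(SC₃)` at the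
NON-Gorenstein two-dimensional normal stages with a singular successor (kernel-certified for every cyclic quotient
`k[u,v]^{1/n(1,q)}`, `…PersistenceCyclicQuotientCharFreeHerzog.cohomologyAnnihilator_eq_four_charFree`), plus `Sat₄`
at a non-normal two-dimensional stage `0`.  Nothing here is asserted unconditionally about those classes.

References (mechanism only): S. B. Iyengar, R. Takahashi, *Annihilation of cohomology and strong generation of
module categories*, IMRN 2016, §2 [`IyengarTakahashi2014`]; M. F. Atiyah, I. G. Macdonald, *Introduction to
Commutative Algebra*, Prop. 5.12 [`AtiyahMacdonald1969`] — both only through landed tree lemmas.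
-/

noncomputable section

-- single-problem summit: the doubled namespace component `ResolutionOfSingularities` is forced
set_option linter.dupNamespace false

namespace Summit.ResolutionOfSingularities.ResolutionOfSingularities.Theorems.HomologicalConductor.PersistenceSurfaceSaturationResidualFourReduction

open CategoryTheory Literature.RingTheory.CohomologyAnnihilator
open Summit.ResolutionOfSingularities.ResolutionOfSingularities.Theorems
open Summit.ResolutionOfSingularities.ResolutionOfSingularities.Theorems.NoZeno.Birth
open Summit.ResolutionOfSingularities.ResolutionOfSingularities.Theorems.HomologicalConductor.PeriodicSaturationStage
open Summit.ResolutionOfSingularities.ResolutionOfSingularities.Theorems.HomologicalConductor.RecurrenceExclusion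
open Summit.ResolutionOfSingularities.ResolutionOfSingularities.Theorems.HomologicalConductor.PersistenceSurfaceSaturationResidual
open Summit.ResolutionOfSingularities.ResolutionOfSingularities.Theorems.HomologicalConductor.PersistenceSurfaceSaturationResidualThree
open Summit.ResolutionOfSingularities.ResolutionOfSingularities.Theorems.HomologicalConductor.PersistenceSurfaceSaturationResidualFour

universe u

/-! ## Stage level: `(SC_d)` at one level gives `ca T ⊆ caAt n T` for `n ≥ d + 1` -/

section Stage

variable {k K : Type u} [Field k] [Field K] [Algebra k K]

/-- **`(SC_d)` at a stage, route vocabulary.** For a subalgebra stage `T ⊆ K` with `↥T` noetherian: if every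
`d`-th syzygy module of a finitely generated `↥T`-module is a retract of a `(d+1)`-th syzygy module of a
finitely generated module, then `ca(↥T) = caᵈ⁺¹(↥T)`
(`RecurrenceExclusion.cohomologyAnnihilator_eq_of_forall_isSyzygy_retract_at`), hence the INLINE sets of the
route satisfy `ca T ⊆ caAt n T` for every `n ≥ d + 1` (`PeriodicSaturationStage.ca_subset_caAt_of_le`).
[cite: IyengarTakahashi2014, §2 (Def. 2.1, Remark 2.3)] -/
theorem ca_subset_caAt_of_forall_isSyzygy_retract_at (T : Subalgebra k K) [IsNoetherianRing ↥T] (d : ℕ)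
    (h : ∀ (M N : ModuleCat.{u} ↥T), Module.Finite ↥T M → IsSyzygy d M N →
      ∃ (M' N' : ModuleCat.{u} ↥T) (i : N ⟶ N') (r : N' ⟶ N),
        Module.Finite ↥T M' ∧ IsSyzygy (d + 1) M' N' ∧ i ≫ r = 𝟙 N)
    {n : ℕ} (hn : d + 1 ≤ n) :
    {x : K | ∃ hx : x ∈ T, ∃ m : ℕ, ∀ i : ℕ, m ≤ i → ∀ (M N : ModuleCat.{u} ↥T),
        Module.Finite ↥T M → Module.Finite ↥T N →
          ∀ e : CategoryTheory.Abelian.Ext.{u} M N i, (⟨x, hx⟩ : ↥T) • e = 0} ⊆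
      {x : K | ∃ hx : x ∈ T, ∀ i : ℕ, n ≤ i → ∀ (M N : ModuleCat.{u} ↥T),
        Module.Finite ↥T M → Module.Finite ↥T N →
          ∀ e : CategoryTheory.Abelian.Ext.{u} M N i, (⟨x, hx⟩ : ↥T) • e = 0} :=
  ca_subset_caAt_of_le T
    ((cohomologyAnnihilator_eq_of_forall_isSyzygy_retract_at (T := ↥T) d h).le.trans
      (cohomologyAnnihilatorOfDegree_mono hn))

end Stage

/-! ## The fourth residual from `(SC₃)` at the residual stages -/

/-- **`(SC₃)` at every residual stage ⇒ `SaturationFourSurfaceResidual₄`.**  If at every stage `T_m` of a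
surface tower satisfying the residual clauses (not regular, not a monic-hypersurface localisation over `k[x,y]`,
not an edim-candidate for `d = 2`, successor singular, Krull dimension `2`) every THIRD syzygy module of a finitely
generated `↥T_m`-module is a retract of a FOURTH syzygy module of a finitely generated module, then the fourth
residual holds: `ca(T_m) ⊆ ca⁴(T_m)` there (`ca_subset_caAt_of_forall_isSyzygy_retract_at` with `d = 3`; the
stage is noetherian by `NoZeno.Birth.stub_towerNoetherian`). [cite: IyengarTakahashi2014, §2] -/
theorem saturationFourSurfaceResidual₄_of_forall_isSyzygy_three_retract
    (h : ∀ p : ℕ, p.Prime → ∀ (k K : Type) [Field k] [CharP k p] [Field K] [Algebra k K]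
      (O : ValuationSubring K) (A : Subalgebra k K), (∀ c : k, algebraMap k K c ∈ O) → A.FG →
      IsFractionRing ↥A K → A.toSubring ≤ O.toSubring → ringKrullDim ↥A ≤ 2 → ∀ m : ℕ,
      ¬ IsRegularLocalRing ↥(tower O A m) → ¬ IsMonicHypersurfaceLocalization k 2 ↥(tower O A m) →
      ¬ IsEdimHypersurfaceCandidate 2 ↥(tower O A m) → ¬ IsRegularLocalRing ↥(tower O A (m + 1)) →
      ringKrullDim ↥(tower O A m) = (2 : ℕ) →
      ∀ (M N : ModuleCat.{0} ↥(tower O A m)), Module.Finite ↥(tower O A m) M → IsSyzygy 3 M N →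
        ∃ (M' N' : ModuleCat.{0} ↥(tower O A m)) (i : N ⟶ N') (r : N' ⟶ N),
          Module.Finite ↥(tower O A m) M' ∧ IsSyzygy 4 M' N' ∧ i ≫ r = 𝟙 N) :
    SaturationFourSurfaceResidual₄ := by
  intro p hp k K _ _ _ _ O A hk hA hfr hAO hdim caAt ca loc chart nrm tower m hreg hmon hcand hsucc hdim2
  haveI : IsNoetherianRing ↥(NoZeno.Birth.tower O A m) := stub_towerNoetherian k K O A hk hA hfr hAO m
  exact ca_subset_caAt_of_forall_isSyzygy_retract_at (NoZeno.Birth.tower O A m) 3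
    (h p hp k K O A hk hA hfr hAO hdim m hreg hmon hcand hsucc hdim2) le_rfl

/-! ## The split «stage 0 / integrally closed stages» -/

/-- **The fourth residual splits into STAGE 0 and the INTEGRALLY CLOSED stages.**  Every stage `T_(m+1)` of
the tower is integrally closed (`d2rc_isIntegrallyClosed_tower_succ`); hence `SaturationFourSurfaceResidual₄`
follows from (0) `Sat₄` at stage `0` (`T_0 = loc A`, possibly non-normal) under the residual clauses, and
(N) `Sat₄` at every INTEGRALLY CLOSED stage under the residual clauses — both in the route's inline vocabulary,
both carried as hypotheses. [cite: AtiyahMacdonald1969, Prop. 5.12] -/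
theorem saturationFourSurfaceResidual₄_of_stageZero_of_isIntegrallyClosed
    (h0 : ∀ p : ℕ, p.Prime → ∀ (k K : Type) [Field k] [CharP k p] [Field K] [Algebra k K]
      (O : ValuationSubring K) (A : Subalgebra k K), (∀ c : k, algebraMap k K c ∈ O) → A.FG →
      IsFractionRing ↥A K → A.toSubring ≤ O.toSubring → ringKrullDim ↥A ≤ 2 →
      ¬ IsRegularLocalRing ↥(tower O A 0) → ¬ IsMonicHypersurfaceLocalization k 2 ↥(tower O A 0) →
      ¬ IsEdimHypersurfaceCandidate 2 ↥(tower O A 0) → ¬ IsRegularLocalRing ↥(tower O A 1) →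
      ringKrullDim ↥(tower O A 0) = (2 : ℕ) →
      {x : K | ∃ hx : x ∈ tower O A 0, ∃ n : ℕ, ∀ i : ℕ, n ≤ i → ∀ (M N : ModuleCat.{0} ↥(tower O A 0)),
          Module.Finite ↥(tower O A 0) M → Module.Finite ↥(tower O A 0) N →
            ∀ e : CategoryTheory.Abelian.Ext.{0} M N i, (⟨x, hx⟩ : ↥(tower O A 0)) • e = 0} ⊆
        {x : K | ∃ hx : x ∈ tower O A 0, ∀ i : ℕ, 4 ≤ i → ∀ (M N : ModuleCat.{0} ↥(tower O A 0)),
          Module.Finite ↥(tower O A 0) M → Module.Finite ↥(tower O A 0) N →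
            ∀ e : CategoryTheory.Abelian.Ext.{0} M N i, (⟨x, hx⟩ : ↥(tower O A 0)) • e = 0})
    (hN : ∀ p : ℕ, p.Prime → ∀ (k K : Type) [Field k] [CharP k p] [Field K] [Algebra k K]
      (O : ValuationSubring K) (A : Subalgebra k K), (∀ c : k, algebraMap k K c ∈ O) → A.FG →
      IsFractionRing ↥A K → A.toSubring ≤ O.toSubring → ringKrullDim ↥A ≤ 2 → ∀ m : ℕ,
      IsIntegrallyClosed ↥(tower O A m) →
      ¬ IsRegularLocalRing ↥(tower O A m) → ¬ IsMonicHypersurfaceLocalization k 2 ↥(tower O A m) →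
      ¬ IsEdimHypersurfaceCandidate 2 ↥(tower O A m) → ¬ IsRegularLocalRing ↥(tower O A (m + 1)) →
      ringKrullDim ↥(tower O A m) = (2 : ℕ) →
      {x : K | ∃ hx : x ∈ tower O A m, ∃ n : ℕ, ∀ i : ℕ, n ≤ i → ∀ (M N : ModuleCat.{0} ↥(tower O A m)),
          Module.Finite ↥(tower O A m) M → Module.Finite ↥(tower O A m) N →
            ∀ e : CategoryTheory.Abelian.Ext.{0} M N i, (⟨x, hx⟩ : ↥(tower O A m)) • e = 0} ⊆
        {x : K | ∃ hx : x ∈ tower O A m, ∀ i : ℕ, 4 ≤ i → ∀ (M N : ModuleCat.{0} ↥(tower O A m)),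
          Module.Finite ↥(tower O A m) M → Module.Finite ↥(tower O A m) N →
            ∀ e : CategoryTheory.Abelian.Ext.{0} M N i, (⟨x, hx⟩ : ↥(tower O A m)) • e = 0}) :
    SaturationFourSurfaceResidual₄ := by
  intro p hp k K _ _ _ _ O A hk hA hfr hAO hdim caAt ca loc chart nrm tower m hreg hmon hcand hsucc hdim2
  cases m with
  | zero => exact h0 p hp k K O A hk hA hfr hAO hdim hreg hmon hcand hsucc hdim2
  | succ n =>
    exact hN p hp k K O A hk hA hfr hAO hdim (n + 1) (d2rc_isIntegrallyClosed_tower_succ O A hk hA hfr hAO n)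
      hreg hmon hcand hsucc hdim2

/-- **The two reductions combined.**  `SaturationFourSurfaceResidual₄` follows from (0) `Sat₄` at stage `0`
under the residual clauses and (N′) the retract property `(SC₃)` — every third syzygy module of a finitely
generated module is a retract of a fourth syzygy module of a finitely generated module — over every INTEGRALLY
CLOSED residual stage `↥(tower O A m)` (a two-dimensional normal local domain essentially of finite type over `k`
whose successor is singular and which is neither a monic-hypersurface localisation nor an edim-candidate).
[cite: IyengarTakahashi2014, §2] -/
theorem saturationFourSurfaceResidual₄_of_stageZero_of_forall_isSyzygy_three_retract_of_isIntegrallyClosed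
    (h0 : ∀ p : ℕ, p.Prime → ∀ (k K : Type) [Field k] [CharP k p] [Field K] [Algebra k K]
      (O : ValuationSubring K) (A : Subalgebra k K), (∀ c : k, algebraMap k K c ∈ O) → A.FG →
      IsFractionRing ↥A K → A.toSubring ≤ O.toSubring → ringKrullDim ↥A ≤ 2 →
      ¬ IsRegularLocalRing ↥(tower O A 0) → ¬ IsMonicHypersurfaceLocalization k 2 ↥(tower O A 0) →
      ¬ IsEdimHypersurfaceCandidate 2 ↥(tower O A 0) → ¬ IsRegularLocalRing ↥(tower O A 1) →
      ringKrullDim ↥(tower O A 0) = (2 : ℕ) →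
      {x : K | ∃ hx : x ∈ tower O A 0, ∃ n : ℕ, ∀ i : ℕ, n ≤ i → ∀ (M N : ModuleCat.{0} ↥(tower O A 0)),
          Module.Finite ↥(tower O A 0) M → Module.Finite ↥(tower O A 0) N →
            ∀ e : CategoryTheory.Abelian.Ext.{0} M N i, (⟨x, hx⟩ : ↥(tower O A 0)) • e = 0} ⊆
        {x : K | ∃ hx : x ∈ tower O A 0, ∀ i : ℕ, 4 ≤ i → ∀ (M N : ModuleCat.{0} ↥(tower O A 0)),
          Module.Finite ↥(tower O A 0) M → Module.Finite ↥(tower O A 0) N →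
            ∀ e : CategoryTheory.Abelian.Ext.{0} M N i, (⟨x, hx⟩ : ↥(tower O A 0)) • e = 0})
    (hN : ∀ p : ℕ, p.Prime → ∀ (k K : Type) [Field k] [CharP k p] [Field K] [Algebra k K]
      (O : ValuationSubring K) (A : Subalgebra k K), (∀ c : k, algebraMap k K c ∈ O) → A.FG →
      IsFractionRing ↥A K → A.toSubring ≤ O.toSubring → ringKrullDim ↥A ≤ 2 → ∀ m : ℕ,
      IsIntegrallyClosed ↥(tower O A m) →
      ¬ IsRegularLocalRing ↥(tower O A m) → ¬ IsMonicHypersurfaceLocalization k 2 ↥(tower O A m) →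
      ¬ IsEdimHypersurfaceCandidate 2 ↥(tower O A m) → ¬ IsRegularLocalRing ↥(tower O A (m + 1)) →
      ringKrullDim ↥(tower O A m) = (2 : ℕ) →
      ∀ (M N : ModuleCat.{0} ↥(tower O A m)), Module.Finite ↥(tower O A m) M → IsSyzygy 3 M N →
        ∃ (M' N' : ModuleCat.{0} ↥(tower O A m)) (i : N ⟶ N') (r : N' ⟶ N),
          Module.Finite ↥(tower O A m) M' ∧ IsSyzygy 4 M' N' ∧ i ≫ r = 𝟙 N) :
    SaturationFourSurfaceResidual₄ := by
  refine saturationFourSurfaceResidual₄_of_stageZero_of_isIntegrallyClosed h0 ?_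
  intro p hp k K _ _ _ _ O A hk hA hfr hAO hdim m hnorm hreg hmon hcand hsucc hdim2
  haveI : IsNoetherianRing ↥(tower O A m) := stub_towerNoetherian k K O A hk hA hfr hAO m
  exact ca_subset_caAt_of_forall_isSyzygy_retract_at (tower O A m) 3
    (hN p hp k K O A hk hA hfr hAO hdim m hnorm hreg hmon hcand hsucc hdim2) le_rfl

end Summit.ResolutionOfSingularities.ResolutionOfSingularities.Theorems.HomologicalConductor.PersistenceSurfaceSaturationResidualFourReduction

end
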